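import Summits.RiemannHypothesis.RiemannHypothesis.Theorems.TiltedLandingLaw421R3RateSkeletonB

/-! # RATE residual `RhW08.RateSplit.RateLawsHalfQ` — LENS-2 WALK MODULE, part A: §K the ABSTRACT CHAIN WALK (pure real analysis)
Landing cut (3l-A) of `rh33346-cover/lens2/RateSkeletonWalk-v2.lean` b58268a5 (farm rc 0 · 0 sorry), l.18–384 verbatim (+ four one-line docstrings):
the walk-back induction of GLUE-G3A in abstract form, namespace `RhW08.BurgersRateG3.ChainWalk` — the creep potential `B`, `B_step`, `B_antitone`,
`B_le_two`, and the two inductions `chain_walk` (child-height form) / `chain_walk2` (state-height form, the one instantiated in part B).  No far-node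
vocabulary occurs here (the statements quantify over abstract sequences `κ y Y : ℕ → ℝ` and charge flags `ch : ℕ → Prop`), so this part is blind to
the simple/moving binder fork of `…R3RateSkeletonB`; it imports that module only to keep the landing chain linear ((B) → (3l-A) → (3l-B) → (3m)).
Part B (`…R3RateSkeletonWalkLaws`) instantiates `chain_walk2` on the PRIMED (moving-child) one-level laws and proves GLUE-G3A.  Sorry-free; axioms
standard.  Nothing here bears on the truth of RH; RH is not proved; 33346/33347 OPEN; checked ≠ proved. -/

/-! # The WALK-BACK INDUCTION of GLUE-G3A in abstract form (lens-2 g3; answers crit-1 CUT 6's flag on `stub_glueG3`)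

Levels `k ≤ i ≤ j` of one frame carry far nodes with fields `κ i` and child heights `y i`; `ch i` = level `i` is charged; `c = η/s`.  The five laws
of the lens-2 chain, read along the chain, are the hypotheses `hE/hX` (entry/exit at `k`), `hCC` (charged cap), `hCB` (below-threshold cap), `hCR`
(creep above the landing zone), `hLZ` (landing exit: no charge two levels past a landing-zone node); `hMONO` (child heights monotone — PROVED in the
instantiation from `RhW08.SuccB.stTrkDQ_succ_of_nested`) and `hDROP` control the creep heights: in `chain_walk` (CHILD form, kept as an
abstract theorem only — its instantiating child-drop law is NOT filed, booked dead in NODE v7a: readiness is state-free) `hDROP` is a child drop `s/4` at a creep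
step; in `chain_walk2` (STATE-HEIGHT form, the one instantiated in §W) `hDROP` is the PROVED `s/4` separation of consecutive lowest states past an
uncharged level (`state_drop`), and the low jumps are paid by `LowLandingLaw`.  CONCLUSION: `κ j ≤ (1+θ)(1+θ')c·exp(θu·Λ₀)` at the charged end.  The creep sum is controlled WITHOUT lists by the potential
`B u = s²/u² + 4s/u` of the last creep height (`B u + s²/y² ≤ B y` whenever `y ≤ u − s/4`).  Every step consumes a charge flag (`hCC` needs `ch (i+1)`,
`hCR`/`hDROP` need `¬ch (i+1)`, `hLZ`/`hX` kill `ch j`): the bookkeeping is not charge-free.  Sorry-free; axioms standard.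
Nothing here bears on the truth of RH; RH is not proved. -/

namespace RhW08.BurgersRateG3.ChainWalk

open Real

/-- the creep potential of a height `u`: a bound for all creep contributions at `s/4`-separated heights in `[ymin, u]`. -/
noncomputable def B (s u : ℝ) : ℝ := s ^ 2 / u ^ 2 + 4 * s / u

/-- (K) the creep potential is nonnegative at nonnegative heights. -/
theorem B_nonneg {s u : ℝ} (hs : 0 ≤ s) (hu : 0 ≤ u) : 0 ≤ B s u := by
  unfold B; positivity

/-- (K) one creep step: descending by at least `s/4` from `u` to `y` pays the creep term `s²/y²` out of the potential. -/
theorem B_step {s u y : ℝ} (hs : 0 < s) (hy : 0 < y) (huy : y ≤ u - s / 4) : B s u + s ^ 2 / y ^ 2 ≤ B s y := by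
  unfold B
  have hyd : 0 < y + s / 4 := by linarith
  have h1 : s ^ 2 / u ^ 2 ≤ s ^ 2 / (y + s / 4) ^ 2 := by
    apply div_le_div_of_nonneg_left (by positivity) (by positivity)
    exact pow_le_pow_left₀ hyd.le (by linarith) 2
  have h2 : 4 * s / u ≤ 4 * s / (y + s / 4) := by
    apply div_le_div_of_nonneg_left (by positivity) hyd (by linarith)
  have key : s ^ 2 / (y + s / 4) ^ 2 ≤ 4 * s / y - 4 * s / (y + s / 4) := by
    rw [div_sub_div _ _ hy.ne' hyd.ne', div_le_div_iff₀ (by positivity) (by positivity)]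
    nlinarith [mul_pos hs hy, mul_pos hs hs, mul_pos hy hy, mul_pos (mul_pos hs hy) hyd]
  linarith

/-- (K) the creep potential is antitone in the height. -/
theorem B_antitone {s u v : ℝ} (hs : 0 < s) (hv : 0 < v) (hvu : v ≤ u) : B s u ≤ B s v := by
  unfold B
  have h1 : s ^ 2 / u ^ 2 ≤ s ^ 2 / v ^ 2 :=
    div_le_div_of_nonneg_left (by positivity) (by positivity) (pow_le_pow_left₀ hv.le hvu 2)
  have h2 : 4 * s / u ≤ 4 * s / v := div_le_div_of_nonneg_left (by positivity) hv hvu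
  linarith

/-- (K) a single creep term is bounded by the potential at its own height. -/
theorem sq_div_le_B {s y : ℝ} (hs : 0 < s) (hy : 0 < y) : s ^ 2 / y ^ 2 ≤ B s y := by
  unfold B; have : 0 ≤ 4 * s / y := by positivity
  linarith

/-- (K) the potential bound in closed form: if `s = (4/5)·t·u` with `0 ≤ t`, `t² ≤ 5/16` then `B s u ≤ 2` (`(16/25)t² + (16/5)t ≤ 1/5 + 9/5`). -/
theorem B_le_two {s u t : ℝ} (hu : 0 < u) (h : s = 4 / 5 * t * u) (ht0 : 0 ≤ t) (ht : t ^ 2 ≤ 5 / 16) : B s u ≤ 2 := by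
  unfold B
  have h1 : s ^ 2 / u ^ 2 = 16 / 25 * t ^ 2 := by rw [h]; field_simp; ring
  have h2 : 4 * s / u = 16 / 5 * t := by rw [h]; field_simp; ring
  rw [h1, h2]
  nlinarith

/-- ★ **THE CHAIN WALK** (forward induction from the entry level `k` to the charged level `j`). -/
theorem chain_walk {κ y : ℕ → ℝ} {ch : ℕ → Prop} {c θ θ' θu s Λ₀ : ℝ} {k j : ℕ} (hkj : k ≤ j)
    (hs : 0 < s) (hc : 0 ≤ c) (hθ : 0 ≤ θ) (hθ' : 0 ≤ θ') (hθu : 0 ≤ θu)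
    (hNUM : B s (5 / (4 * ((1 + θ) * (1 + θ') * c * exp (θu * Λ₀)))) ≤ Λ₀)
    (hchj : ch j)
    (hE : ch k → κ k ≤ (1 + θ') * c)
    (hX : ¬ ch k → (1 + θ') * c < κ k → ∀ i, k ≤ i → i ≤ j → ¬ ch i)
    (hCC : ∀ i, k ≤ i → i < j → ch (i + 1) → κ (i + 1) ≤ max (κ i) ((1 + θ) * c))
    (hCB : ∀ i, k ≤ i → i < j → κ i ≤ (1 + θ) * c → κ (i + 1) ≤ (1 + θ) * c)
    (hCR : ∀ i, k ≤ i → i < j → ¬ ch (i + 1) → (1 + θ) * c < κ i → 5 / 4 ≤ κ i * y i →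
      κ (i + 1) ≤ κ i * (1 + θu * (s ^ 2 / y i ^ 2)))
    (hLZ : ∀ i, k ≤ i → i < j → (1 + θ) * c < κ i → κ i * y i < 5 / 4 → ∀ i', i + 2 ≤ i' → i' ≤ j → ¬ ch i')
    (hMONO : ∀ i, k ≤ i → i < j → y (i + 1) ≤ y i)
    (hDROP : ∀ i, k ≤ i → i + 2 ≤ j → ¬ ch (i + 1) → (1 + θ) * c < κ i → 5 / 4 ≤ κ i * y i → y (i + 1) ≤ y i - s / 4) :
    κ j ≤ (1 + θ) * (1 + θ') * c * exp (θu * Λ₀) := by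
  set A : ℝ := (1 + θ) * (1 + θ') * c with hA_def
  set K : ℝ := A * exp (θu * Λ₀) with hK_def
  set ymin : ℝ := 5 / (4 * K) with hymin_def
  have hA0 : 0 ≤ A := by rw [hA_def]; positivity
  have hAc : (1 + θ) * c ≤ A := by
    rw [hA_def]; nlinarith [mul_nonneg (mul_nonneg (by linarith : (0:ℝ) ≤ 1 + θ) hθ') hc]
  have hθ'c : (1 + θ') * c ≤ A := by
    rw [hA_def]; nlinarith [mul_nonneg (mul_nonneg (by linarith : (0:ℝ) ≤ 1 + θ') hθ) hc]
  have hθc0 : 0 ≤ (1 + θ) * c := by positivity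
  have hK0 : 0 ≤ K := by rw [hK_def]; positivity
  have hymin_nn : 0 ≤ ymin := by rw [hymin_def]; positivity
  have hNUM' : B s ymin ≤ Λ₀ := by rw [hymin_def, hK_def, hA_def]; exact hNUM
  have hΛ0 : 0 ≤ Λ₀ := le_trans (B_nonneg hs.le hymin_nn) hNUM'
  have hAK : A ≤ K := by
    rw [hK_def]
    have : 1 ≤ exp (θu * Λ₀) := one_le_exp_iff.2 (mul_nonneg hθu hΛ0)
    nlinarith
  -- exp(θu * B u) ≤ exp(θu * Λ₀) for u ≥ ymin > 0
  have hexpB : ∀ u, 0 < ymin → ymin ≤ u → A * exp (θu * B s u) ≤ K := by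
    intro u hy0 hu
    rw [hK_def]
    apply mul_le_mul_of_nonneg_left _ hA0
    apply exp_le_exp.2
    apply mul_le_mul_of_nonneg_left _ hθu
    exact (B_antitone hs hy0 hu).trans hNUM'
  -- the invariant
  have inv : ∀ n : ℕ, k + n ≤ j →
      (κ (k + n) ≤ A ∨ ∃ u, 0 < ymin ∧ ymin ≤ u ∧ y (k + n) ≤ u - s / 4 ∧ κ (k + n) ≤ A * exp (θu * B s u)) := by
    intro n
    induction n with
    | zero =>
      intro _
      left
      simp only [Nat.add_zero]
      by_cases hk : ch k
      · exact (hE hk).trans hθ'c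
      · by_contra hlt
        rw [not_le] at hlt
        exact hX hk (lt_of_le_of_lt hθ'c hlt) j hkj le_rfl hchj
    | succ n ih =>
      intro hn
      have hi : k + n < j := by omega
      have hki : k ≤ k + n := by omega
      have ih' := ih hi.le
      rw [show k + (n + 1) = k + n + 1 by omega]
      have hκK : κ (k + n) ≤ K := by
        rcases ih' with h | ⟨u, hy0, hu, _, hκ⟩
        · exact h.trans hAK
        · exact hκ.trans (hexpB u hy0 hu)
      by_cases hch : ch (k + n + 1)
      · -- charged successor: cap
        have hcap := hCC (k + n) hki hi hch
        rcases ih' with h | ⟨u, hy0, hu, hyu, hκ⟩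
        · left
          exact hcap.trans (max_le h hAc)
        · right
          refine ⟨u, hy0, hu, (hMONO (k + n) hki hi).trans hyu, hcap.trans (max_le hκ ?_)⟩
          have hu0 : 0 < u := lt_of_lt_of_le hy0 hu
          have : 1 ≤ exp (θu * B s u) := one_le_exp_iff.2 (mul_nonneg hθu (B_nonneg hs.le hu0.le))
          nlinarith
      · by_cases hlow : κ (k + n) ≤ (1 + θ) * c
        · -- below threshold: cap-below
          left
          exact (hCB (k + n) hki hi hlow).trans hAc
        · rw [not_le] at hlow
          have hκpos : 0 < κ (k + n) := lt_of_le_of_lt hθc0 hlow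
          by_cases hlz : κ (k + n) * y (k + n) < 5 / 4
          · -- landing zone: no later charge; contradiction with ch j
            exfalso
            by_cases hj : j = k + n + 1
            · exact hch (hj ▸ hchj)
            · exact hLZ (k + n) hki hi hlow hlz j (by omega) le_rfl hchj
          · -- creep step
            rw [not_lt] at hlz
            have hy0 : 0 < y (k + n) := by
              by_contra h; rw [not_lt] at h
              nlinarith [mul_nonpos_iff.2 (Or.inl ⟨hκpos.le, h⟩)]
            have hKpos : 0 < K := lt_of_lt_of_le hκpos hκK
            have hymin0 : 0 < ymin := by rw [hymin_def]; positivity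
            have hcr := hCR (k + n) hki hi hch hlow hlz
            have hj2 : k + n + 2 ≤ j := by
              by_contra h
              have : j = k + n + 1 := by omega
              exact hch (this ▸ hchj)
            have hdrop := hDROP (k + n) hki hj2 hch hlow hlz
            have hyge : ymin ≤ y (k + n) := by
              rw [hymin_def, div_le_iff₀ (by positivity)]
              nlinarith [mul_le_mul_of_nonneg_right hκK hy0.le]
            have hfac : 0 ≤ 1 + θu * (s ^ 2 / y (k + n) ^ 2) := by positivity
            right
            refine ⟨y (k + n), hymin0, hyge, hdrop, ?_⟩
            rcases ih' with h | ⟨u, _, hu, hyu, hκ⟩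
            · -- first creep
              calc κ (k + n + 1) ≤ κ (k + n) * (1 + θu * (s ^ 2 / y (k + n) ^ 2)) := hcr
                _ ≤ A * (1 + θu * (s ^ 2 / y (k + n) ^ 2)) := mul_le_mul_of_nonneg_right h hfac
                _ ≤ A * exp (θu * (s ^ 2 / y (k + n) ^ 2)) := by
                    apply mul_le_mul_of_nonneg_left _ hA0
                    have := Real.add_one_le_exp (θu * (s ^ 2 / y (k + n) ^ 2)); linarith
                _ ≤ A * exp (θu * B s (y (k + n))) := by
                    apply mul_le_mul_of_nonneg_left _ hA0
                    exact exp_le_exp.2 (mul_le_mul_of_nonneg_left (sq_div_le_B hs hy0) hθu)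
            · -- later creep: potential step B u + s²/y² ≤ B y
              calc κ (k + n + 1) ≤ κ (k + n) * (1 + θu * (s ^ 2 / y (k + n) ^ 2)) := hcr
                _ ≤ A * exp (θu * B s u) * (1 + θu * (s ^ 2 / y (k + n) ^ 2)) := mul_le_mul_of_nonneg_right hκ hfac
                _ ≤ A * exp (θu * B s u) * exp (θu * (s ^ 2 / y (k + n) ^ 2)) := by
                    apply mul_le_mul_of_nonneg_left _ (by positivity)
                    have := Real.add_one_le_exp (θu * (s ^ 2 / y (k + n) ^ 2)); linarith
                _ = A * exp (θu * (B s u + s ^ 2 / y (k + n) ^ 2)) := by rw [mul_add, Real.exp_add]; ring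
                _ ≤ A * exp (θu * B s (y (k + n))) := by
                    apply mul_le_mul_of_nonneg_left _ hA0
                    exact exp_le_exp.2 (mul_le_mul_of_nonneg_left (B_step hs hy0 hyu) hθu)
  have hfin := inv (j - k) (by omega)
  rw [show k + (j - k) = j by omega] at hfin
  rcases hfin with h | ⟨u, hy0, hu, _, hκ⟩
  · exact h.trans hAK
  · exact hκ.trans (hexpB u hy0 hu)

set_option maxHeartbeats 800000 in
/-- ★★ **THE CHAIN WALK, STATE-HEIGHT FORM** (v3, the one instantiated): creep heights are the NEXT lowest-state heights `Y i` (`≤ y i`, monotone,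
and dropping `s/4` after an uncharged level whenever a later level is charged — all PROVED on far nodes), the landing zone is read twice (child form
`hLZ` at node `i`: no charge from `i+2`; state form `hLOW`: `κ_i·Y_i < 5/4` ⇒ no charge from `i+3`), and the one sub-case «`κ_i·Y_i < 5/4 ≤ κ_i·y_i`»
(the chain jumps to a low pair) costs a single unseparated creep factor at the very end: conclusion `κ j ≤ K·(1 + θu·s²/Ymin²)`, `Ymin = 5/(4K)`. -/
theorem chain_walk2 {κ y Y : ℕ → ℝ} {ch : ℕ → Prop} {c θ θ' θu s Λ₀ : ℝ} {k j : ℕ} (hkj : k ≤ j)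
    (hs : 0 < s) (hc : 0 ≤ c) (hθ : 0 ≤ θ) (hθ' : 0 ≤ θ') (hθu : 0 ≤ θu)
    (hNUM : B s (5 / (4 * ((1 + θ) * (1 + θ') * c * exp (θu * Λ₀)))) ≤ Λ₀)
    (hchj : ch j)
    (hE : ch k → κ k ≤ (1 + θ') * c)
    (hX : ¬ ch k → (1 + θ') * c < κ k → ∀ i, k ≤ i → i ≤ j → ¬ ch i)
    (hCC : ∀ i, k ≤ i → i < j → ch (i + 1) → κ (i + 1) ≤ max (κ i) ((1 + θ) * c))
    (hCB : ∀ i, k ≤ i → i < j → κ i ≤ (1 + θ) * c → κ (i + 1) ≤ (1 + θ) * c)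
    (hCR : ∀ i, k ≤ i → i < j → ¬ ch (i + 1) → (1 + θ) * c < κ i → 5 / 4 ≤ κ i * y i →
      κ (i + 1) ≤ κ i * (1 + θu * (s ^ 2 / y i ^ 2)))
    (hLZ : ∀ i, k ≤ i → i < j → (1 + θ) * c < κ i → κ i * y i < 5 / 4 → ∀ i', i + 2 ≤ i' → i' ≤ j → ¬ ch i')
    (hLOW : ∀ i, k ≤ i → i < j → (1 + θ) * c < κ i → κ i * Y i < 5 / 4 → ∀ i', i + 3 ≤ i' → i' ≤ j → ¬ ch i')
    (hYy : ∀ i, k ≤ i → i < j → Y i ≤ y i)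
    (hMONO : ∀ i, k ≤ i → i + 1 < j → Y (i + 1) ≤ Y i)
    (hDROP : ∀ i, k ≤ i → i + 2 ≤ j → ¬ ch (i + 1) → Y (i + 1) ≤ Y i - s / 4) :
    κ j ≤ (1 + θ) * (1 + θ') * c * exp (θu * Λ₀) *
      (1 + θu * (s ^ 2 / (5 / (4 * ((1 + θ) * (1 + θ') * c * exp (θu * Λ₀)))) ^ 2)) := by
  set A : ℝ := (1 + θ) * (1 + θ') * c with hA_def
  set K : ℝ := A * exp (θu * Λ₀) with hK_def
  set ymin : ℝ := 5 / (4 * K) with hymin_def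
  have hA0 : 0 ≤ A := by rw [hA_def]; positivity
  have hAc : (1 + θ) * c ≤ A := by
    rw [hA_def]; nlinarith [mul_nonneg (mul_nonneg (by linarith : (0:ℝ) ≤ 1 + θ) hθ') hc]
  have hθ'c : (1 + θ') * c ≤ A := by
    rw [hA_def]; nlinarith [mul_nonneg (mul_nonneg (by linarith : (0:ℝ) ≤ 1 + θ') hθ) hc]
  have hθc0 : 0 ≤ (1 + θ) * c := by positivity
  have hK0 : 0 ≤ K := by rw [hK_def]; positivity
  have hymin_nn : 0 ≤ ymin := by rw [hymin_def]; positivity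
  have hNUM' : B s ymin ≤ Λ₀ := by rw [hymin_def, hK_def, hA_def]; exact hNUM
  have hΛ0 : 0 ≤ Λ₀ := le_trans (B_nonneg hs.le hymin_nn) hNUM'
  have hAK : A ≤ K := by
    rw [hK_def]
    have : 1 ≤ exp (θu * Λ₀) := one_le_exp_iff.2 (mul_nonneg hθu hΛ0)
    nlinarith
  set K' : ℝ := K * (1 + θu * (s ^ 2 / ymin ^ 2)) with hK'_def
  have hKK' : K ≤ K' := by
    rw [hK'_def]
    have : 0 ≤ θu * (s ^ 2 / ymin ^ 2) := by positivity
    nlinarith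
  have hexpB : ∀ u, 0 < ymin → ymin ≤ u → A * exp (θu * B s u) ≤ K := by
    intro u hy0 hu
    rw [hK_def]
    apply mul_le_mul_of_nonneg_left _ hA0
    apply exp_le_exp.2
    apply mul_le_mul_of_nonneg_left _ hθu
    exact (B_antitone hs hy0 hu).trans hNUM'
  -- the invariant (three shapes)
  have inv : ∀ n : ℕ, k + n ≤ j →
      (κ (k + n) ≤ A ∨
       (∃ u, 0 < ymin ∧ ymin ≤ u ∧ (k + n < j → Y (k + n) ≤ u - s / 4) ∧ κ (k + n) ≤ A * exp (θu * B s u)) ∨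
       (0 < ymin ∧ κ (k + n) ≤ K' ∧ (k + n + 1 = j ∨ k + n = j))) := by
    intro n
    induction n with
    | zero =>
      intro _
      left
      simp only [Nat.add_zero]
      by_cases hk : ch k
      · exact (hE hk).trans hθ'c
      · by_contra hlt
        rw [not_le] at hlt
        exact hX hk (lt_of_le_of_lt hθ'c hlt) j hkj le_rfl hchj
    | succ n ih =>
      intro hn
      have hi : k + n < j := by omega
      have hki : k ≤ k + n := by omega
      have ih' := ih hi.le
      rw [show k + (n + 1) = k + n + 1 by omega]
      by_cases hch : ch (k + n + 1)
      · -- charged successor: cap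
        have hcap := hCC (k + n) hki hi hch
        rcases ih' with h | ⟨u, hy0, hu, hyu, hκ⟩ | ⟨hy0, hκ, hlast⟩
        · left
          exact hcap.trans (max_le h hAc)
        · right; left
          refine ⟨u, hy0, hu, fun hlt => (hMONO (k + n) hki hlt).trans (hyu hi), hcap.trans (max_le hκ ?_)⟩
          have hu0 : 0 < u := lt_of_lt_of_le hy0 hu
          have : 1 ≤ exp (θu * B s u) := one_le_exp_iff.2 (mul_nonneg hθu (B_nonneg hs.le hu0.le))
          nlinarith
        · right; right
          refine ⟨hy0, hcap.trans (max_le hκ (hAc.trans (hAK.trans hKK'))), Or.inr (by omega)⟩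
      · -- uncharged successor: the third shape is impossible (it says the next level is the charged end)
        have hκK : κ (k + n) ≤ K := by
          rcases ih' with h | ⟨u, hy0, hu, _, hκ⟩ | ⟨_, _, hlast⟩
          · exact h.trans hAK
          · exact hκ.trans (hexpB u hy0 hu)
          · exfalso
            rcases hlast with h1 | h2
            · exact hch (h1 ▸ hchj)
            · omega
        by_cases hlow : κ (k + n) ≤ (1 + θ) * c
        · left
          exact (hCB (k + n) hki hi hlow).trans hAc
        · rw [not_le] at hlow
          have hκpos : 0 < κ (k + n) := lt_of_le_of_lt hθc0 hlow
          have hKpos : 0 < K := lt_of_lt_of_le hκpos hκK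
          have hymin0 : 0 < ymin := by rw [hymin_def]; positivity
          have hj2 : k + n + 2 ≤ j := by
            by_contra h
            have : j = k + n + 1 := by omega
            exact hch (this ▸ hchj)
          by_cases hlz : κ (k + n) * y (k + n) < 5 / 4
          · -- landing zone (child form): no charge from level k+n+2 on — contradiction
            exfalso
            exact hLZ (k + n) hki hi hlow hlz j hj2 le_rfl hchj
          · rw [not_lt] at hlz
            have hy0 : 0 < y (k + n) := by
              by_contra h; rw [not_lt] at h
              linarith [mul_nonpos_iff.2 (Or.inl ⟨hκpos.le, h⟩)]
            have hcr := hCR (k + n) hki hi hch hlow hlz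
            have hyge : ymin ≤ y (k + n) := by
              rw [hymin_def, div_le_iff₀ (by positivity)]
              linarith [mul_le_mul_of_nonneg_right hκK hy0.le]
            by_cases hLZY : κ (k + n) * Y (k + n) < 5 / 4
            · -- the chain jumps to a LOW pair: no charge from k+n+3 on, so j = k+n+2; one unseparated creep factor
              have hj3 : j = k + n + 2 := by
                by_contra h
                exact hLOW (k + n) hki hi hlow hLZY j (by omega) le_rfl hchj
              right; right
              refine ⟨hymin0, ?_, Or.inl (by omega)⟩
              have hfac : 0 ≤ 1 + θu * (s ^ 2 / y (k + n) ^ 2) := by positivity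
              have hyy : s ^ 2 / y (k + n) ^ 2 ≤ s ^ 2 / ymin ^ 2 :=
                div_le_div_of_nonneg_left (by positivity) (by positivity) (pow_le_pow_left₀ hymin0.le hyge 2)
              calc κ (k + n + 1) ≤ κ (k + n) * (1 + θu * (s ^ 2 / y (k + n) ^ 2)) := hcr
                _ ≤ K * (1 + θu * (s ^ 2 / y (k + n) ^ 2)) := mul_le_mul_of_nonneg_right hκK hfac
                _ ≤ K * (1 + θu * (s ^ 2 / ymin ^ 2)) := by
                    apply mul_le_mul_of_nonneg_left _ hKpos.le
                    linarith [mul_le_mul_of_nonneg_left hyy hθu]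
            · -- genuine creep step, booked at the state height Y (k+n)
              rw [not_lt] at hLZY
              have hY0 : 0 < Y (k + n) := by
                by_contra h; rw [not_lt] at h
                linarith [mul_nonpos_iff.2 (Or.inl ⟨hκpos.le, h⟩)]
              have hYge : ymin ≤ Y (k + n) := by
                rw [hymin_def, div_le_iff₀ (by positivity)]
                linarith [mul_le_mul_of_nonneg_right hκK hY0.le]
              have hYy' := hYy (k + n) hki hi
              have hyY : s ^ 2 / y (k + n) ^ 2 ≤ s ^ 2 / Y (k + n) ^ 2 :=
                div_le_div_of_nonneg_left (by positivity) (by positivity) (pow_le_pow_left₀ hY0.le hYy' 2)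
              have hfacY : 0 ≤ 1 + θu * (s ^ 2 / Y (k + n) ^ 2) := by positivity
              have hcrY : κ (k + n + 1) ≤ κ (k + n) * (1 + θu * (s ^ 2 / Y (k + n) ^ 2)) :=
                hcr.trans (by apply mul_le_mul_of_nonneg_left _ hκpos.le; linarith [mul_le_mul_of_nonneg_left hyY hθu])
              right; left
              refine ⟨Y (k + n), hymin0, hYge, fun hlt => hDROP (k + n) hki (by omega) hch, ?_⟩
              rcases ih' with h | ⟨u, _, hu, hyu, hκ⟩ | ⟨_, _, hlast⟩
              · calc κ (k + n + 1) ≤ κ (k + n) * (1 + θu * (s ^ 2 / Y (k + n) ^ 2)) := hcrY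
                  _ ≤ A * (1 + θu * (s ^ 2 / Y (k + n) ^ 2)) := mul_le_mul_of_nonneg_right h hfacY
                  _ ≤ A * exp (θu * (s ^ 2 / Y (k + n) ^ 2)) := by
                      apply mul_le_mul_of_nonneg_left _ hA0
                      have := Real.add_one_le_exp (θu * (s ^ 2 / Y (k + n) ^ 2)); linarith
                  _ ≤ A * exp (θu * B s (Y (k + n))) := by
                      apply mul_le_mul_of_nonneg_left _ hA0
                      exact exp_le_exp.2 (mul_le_mul_of_nonneg_left (sq_div_le_B hs hY0) hθu)
              · calc κ (k + n + 1) ≤ κ (k + n) * (1 + θu * (s ^ 2 / Y (k + n) ^ 2)) := hcrY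
                  _ ≤ A * exp (θu * B s u) * (1 + θu * (s ^ 2 / Y (k + n) ^ 2)) := mul_le_mul_of_nonneg_right hκ hfacY
                  _ ≤ A * exp (θu * B s u) * exp (θu * (s ^ 2 / Y (k + n) ^ 2)) := by
                      apply mul_le_mul_of_nonneg_left _ (by positivity)
                      have := Real.add_one_le_exp (θu * (s ^ 2 / Y (k + n) ^ 2)); linarith
                  _ = A * exp (θu * (B s u + s ^ 2 / Y (k + n) ^ 2)) := by rw [mul_add, Real.exp_add]; ring
                  _ ≤ A * exp (θu * B s (Y (k + n))) := by
                      apply mul_le_mul_of_nonneg_left _ hA0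
                      exact exp_le_exp.2 (mul_le_mul_of_nonneg_left (B_step hs hY0 (hyu hi)) hθu)
              · exfalso
                rcases hlast with h1 | h2
                · exact hch (h1 ▸ hchj)
                · omega
  have hfin := inv (j - k) (by omega)
  rw [show k + (j - k) = j by omega] at hfin
  show κ j ≤ K'
  rcases hfin with h | ⟨u, hy0, hu, _, hκ⟩ | ⟨_, hκ, _⟩
  · exact h.trans (hAK.trans hKK')
  · exact (hκ.trans (hexpB u hy0 hu)).trans hKK'
  · exact hκ

end RhW08.BurgersRateG3.ChainWalk
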